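import Literature.AlgebraicGeometry.AbelianSchemes.AbelianSchemeDualTransportOfBaseChange
import Literature.AlgebraicGeometry.GroupSchemes.BarsottiTateGroupBaseChange
import Literature.AlgebraicGeometry.GroupSchemes.GroupSchemeBaseChangeSquarePoints
import HarnessLib

/-!
# Serre–Tate, essential surjectivity — the REDUCTION SQUARE of a quotient `π : Y ↠ X` along a square-zero thickening:
# the reduction `π₀` of `π` (a homomorphism, finite flat surjective) and the TOWER COMPATIBILITY of any `p`-dividing chart
# ([Katz1981SerreTate] §1.2, proof of Thm. 1.2.1, p. 142)

Layer `Literature/AlgebraicGeometry/AbelianSchemes`, namespace `Literature.AlgebraicGeometry.AbelianSchemes.SerreTate`.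
THEOREMS ONLY (no definition, no named fact, no instance, no notation, no `sorry`).

THE PRINT.  [Katz1981SerreTate] Thm. 1.2.1 (Serre–Tate), ESSENTIAL SURJECTIVITY (proof, p. 142): given an abelian scheme `X₀` over
`R₀ = R⧸I`, a `p`-divisible group `B` over `R` and `B ×_R R₀ ≅ X₀[p^∞]`, one realises the lift `X` of `X₀` as a QUOTIENT `X = Y ⧸ Z` of an
auxiliary abelian scheme `Y` (with `Y ×_R R₀ ≅ X₀` through a chart `GY` dividing by `p`: `[p] ∘ (·) = π ∘ GY`) by a finite flat subgroup
`Z = B[p²] ↪ Y`; then `X ×_R R₀ ≅ X₀` and the towers `B[pⁿ] ↪ X`, `B₀[pⁿ] ↪ X₀` correspond.  This file supplies two generic steps of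
that bookkeeping, in SCHEME currency along a square-zero thickening `Spec (A⧸J) ↪ Spec A` (`A` Artinian local, `p` nilpotent, `𝔪_A·J = 0`),
with Barsotti–Tate groups in Tate's form (★ `GroupSchemes.BTGroup`, ★ `BTGroup.IsBaseChangeVia`) presented as kernels (`IsTorsionTower`
unfolded: homomorphisms `i n : B.G n ↪ X`, cartesian against `[pⁿ]`, compatible with the transitions):

* §1 **`exists_reductionOfQuotient`** — the REDUCTION `π₀ : X₀ → X ×_A (A⧸J)` of `π` modulo `J` through the chart `GY : X₀ ≅ Y ×_A (A⧸J)`: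
  a HOMOMORPHISM with `π₀ ≫ pr₁ = GY ≫ π`, finite, flat and surjective.  Road: `π₀ := (X₀ ≅ Y ×_A (A⧸J)) ≫ (π ×_A (A⧸J))` with the
  comparison isomorphism OF GROUP SCHEMES ★ `IsBaseChangeVia.isoBaseChange` (★ `isMonHom_isoBaseChange_hom`) and the base change of `π`
  along the cartesian-monoidal `Over.pullback` (a homomorphism; finite ∕ flat ∕ surjective by ★ `of_pullback_map_left`).
* §2 **`towerCompatibility_of_pDividingChart`** — for ANY chart `G : X₀ → X` over `Spec (A⧸J) ↪ Spec A` DIVIDING `GY ≫ π` BY `p`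
  (`[p] ≫ G = GY ≫ π`), the towers match: `i₀ n ≫ G = c n ≫ iX n`.  Road: test against the faithfully flat (hence epimorphic)
  `[p²] = pMap ∘ pMap : B₀[pⁿ⁺²] ↠ B₀[pⁿ]`; `pMap ≫ pMap ≫ i₀ n = (i₀ (n+2))^p ≫ [p]` (§0 `pMap_pMap_comp_eq_pow_comp_pow_id`), then the
  dividing relation, the reduction clause `c ≫ β = (i₀)^p ≫ GY`, the relation `pMap ≫ pMap ≫ iX = β ≫ π`, and `c` commutes with `pMap`
  (§0 `pMap_left_comp_of_isBaseChangeVia`, from the `η`∕`μ`-clauses of ★ `BTGroup.IsBaseChangeVia` through ★ `pow_left_comp_eq_of_sq`).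
* §0 layer plumbing: `pow_id_left_comp_of_isBaseChangeVia` (`[N]` commutes with a base-change square of BT groups, layerwise),
  `pMap_left_comp_of_isBaseChangeVia`, `pMap_comp_eq_pow_of_incl_comp`, `pMap_pMap_comp_eq_pow_comp_pow_id`.

The two main statements are the organs E4P `stub_E4P_reductionOfPi` and E4T `stub_E4T_towerCompatibility` of the sub-sub-line
`Cruxes/HLiu418/Lines/F0_P6b_Sigma2ReductionOfQuotient.lean` (desk F0P6b-plan (g13), ED. 1 cand 1c901d16f319bd37) TOKEN FOR TOKEN, except that
the `Cruxes`-local predicate `F0P6bBTSerreTateDefs.IsTorsionTower` (not importable here) is replaced by its body (definitionally equal).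
Cell hodgecm-mathlib (D-0151 ∕ D-0183 FLOOR 0), P6 Row 4B «σ2», deal P6b-A8 (prover «LH5» LH5-p02 (g14)); generic, count-neutral capital on
`--supports stmt-HodgeConjecture-24832`.  HC_CM is proved only modulo the printed citations until rung 0 closes; nothing here is about HC.

## References
* [Katz1981SerreTate] N. M. Katz, *Serre–Tate local moduli*, in: Surfaces algébriques (Orsay 1976–78), LNM 868 (1981), Exp. V-bis, §1.2
  Thm. 1.2.1 and its proof (p. 142).
* [Messing1972] W. Messing, *The Crystals Associated to Barsotti–Tate Groups*, LNM 264 (1972), Ch. I (1.1)–(1.6).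
* [Tate1967] J. T. Tate, *p-divisible groups*, Proc. Conf. Local Fields (Driebergen 1966), Springer (1967), §2 (2.1).
* [MumfordFogartyKirwan1994] D. Mumford, J. Fogarty, F. Kirwan, *Geometric Invariant Theory*, 3rd ed. (1994), Ch. 7 §2 Definition 7.2
  (p. 129).
* [GortzWedhorn2020] U. Görtz, T. Wedhorn, *Algebraic Geometry I*, 2nd ed. (2020), Section (4.7) (pp. 107–108).
-/

set_option backward.isDefEq.respectTransparency false

noncomputable section

open CategoryTheory CategoryTheory.Limits AlgebraicGeometry MonoidalCategory CartesianMonoidalCategory IsLocalRing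
open scoped MonObj CategoryTheory.Obj

universe u

namespace Literature.AlgebraicGeometry.AbelianSchemes

namespace SerreTate

open Literature.AlgebraicGeometry.GroupSchemes

/-! ### §0 Layer plumbing for Barsotti–Tate groups: `[N]` and `pMap` through a base-change square; towers and `pMap` -/

/-- **`[N]` commutes with a base-change square of Barsotti–Tate groups, layerwise**: for `c : B₀ → B` over `g : S' → S` (★
`BTGroup.IsBaseChangeVia`: each `c n` cartesian and compatible with `η` and `μ`), `[N]_{B₀.G n} ≫ c n = c n ≫ [N]_{B.G n}` on underlying schemes
(★ `pow_left_comp_eq_of_sq` at the tautological point `𝟙`). [cite: Messing1972, Ch. I (1.1)–(1.6)] -/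
theorem pow_id_left_comp_of_isBaseChangeVia {S S' : Scheme.{u}} {p h : ℕ} {B₀ : BTGroup S' p h} {B : BTGroup S p h} {g : S' ⟶ S}
    {c : ∀ n, (B₀.G n).left ⟶ (B.G n).left} (hc : B₀.IsBaseChangeVia B g c) (n N : ℕ) :
    (letI := B₀.grpObj n; ((𝟙 (B₀.G n) : B₀.G n ⟶ B₀.G n) ^ N).left) ≫ c n =
      c n ≫ (letI := B.grpObj n; ((𝟙 (B.G n) : B.G n ⟶ B.G n) ^ N).left) := by
  letI := B₀.grpObj n
  letI := B.grpObj n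
  obtain ⟨w, -, hη, hμ⟩ := hc.1 n
  have hY := pow_left_comp_eq_of_sq (M := B.G n) (M' := B₀.G n) w hη hμ (𝟙 (B₀.G n)) (b := (B₀.G n).hom ≫ g) rfl
    (Over.homMk (c n) w : Over.mk ((B₀.G n).hom ≫ g) ⟶ B.G n) (by simp) N
  rw [hY, ← Category.comp_id (Over.homMk (c n) w : Over.mk ((B₀.G n).hom ≫ g) ⟶ B.G n), ← MonObj.comp_pow,
    Over.comp_left]
  rfl

/-- **A base-change square of Barsotti–Tate groups commutes with the `[p]`-maps**: `pMap n ≫ c n = c (n+1) ≫ pMap n` on underlying schemes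
(compose with the monomorphism `incl n`, use `pMap ≫ incl = [p]` on both sides, the `incl`-clause of ★ `BTGroup.IsBaseChangeVia` and
`pow_id_left_comp_of_isBaseChangeVia`). [cite: Messing1972, Ch. I (1.1)–(1.6)] [cite: Tate1967, §2 (2.1)] -/
theorem pMap_left_comp_of_isBaseChangeVia {S S' : Scheme.{u}} {p h : ℕ} {B₀ : BTGroup S' p h} {B : BTGroup S p h} {g : S' ⟶ S}
    {c : ∀ n, (B₀.G n).left ⟶ (B.G n).left} (hc : B₀.IsBaseChangeVia B g c) (n : ℕ) :
    (B₀.pMap n).left ≫ c n = c (n + 1) ≫ (B.pMap n).left := by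
  letI := B₀.grpObj (n + 1)
  letI := B.grpObj (n + 1)
  haveI := B.isClosedImmersion_incl n
  rw [← cancel_mono (B.incl n).left, Category.assoc, Category.assoc, ← hc.2 n, ← Category.assoc, ← Over.comp_left,
    B₀.pMap_incl n, pow_id_left_comp_of_isBaseChangeVia hc (n + 1) p, ← Over.comp_left, B.pMap_incl n]

/-- **In a kernel tower `i n : B.G n ↪ M` (homomorphisms compatible with the transitions `incl`), `pMap n ≫ i n = (i (n+1))^p`**:
`pMap ≫ incl = [p]` and `i (n+1)` is a homomorphism. [cite: Tate1967, §2 (2.1)] -/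
theorem pMap_comp_eq_pow_of_incl_comp {S : Scheme.{u}} {p h : ℕ} (B : BTGroup S p h) {M : Over S} [MonObj M] (i : ∀ n, B.G n ⟶ M)
    (hi : ∀ n, letI := B.grpObj n; IsMonHom (i n)) (hcomp : ∀ n, B.incl n ≫ i (n + 1) = i n) (n : ℕ) :
    B.pMap n ≫ i n = i (n + 1) ^ p := by
  letI := B.grpObj (n + 1)
  haveI := hi (n + 1)
  rw [← hcomp n, ← Category.assoc, B.pMap_incl n, MonObj.pow_comp, Category.id_comp]

/-- **`[p²]` through a kernel tower**: `pMap (n+1) ≫ pMap n ≫ i n = (i (n+2))^p ≫ [p]_M`. [cite: Tate1967, §2 (2.1)] -/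
theorem pMap_pMap_comp_eq_pow_comp_pow_id {S : Scheme.{u}} {p h : ℕ} (B : BTGroup S p h) {M : Over S} [MonObj M]
    (i : ∀ n, B.G n ⟶ M) (hi : ∀ n, letI := B.grpObj n; IsMonHom (i n)) (hcomp : ∀ n, B.incl n ≫ i (n + 1) = i n) (n : ℕ) :
    B.pMap (n + 1) ≫ B.pMap n ≫ i n = (i (n + 2) ^ p) ≫ ((𝟙 M : M ⟶ M) ^ p) := by
  rw [pMap_comp_eq_pow_of_incl_comp B i hi hcomp n, MonObj.comp_pow, pMap_comp_eq_pow_of_incl_comp B i hi hcomp (n + 1),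
    MonObj.comp_pow, Category.comp_id]

/-! ### §1 The reduction `π₀` of the quotient map `π` modulo `J` -/

/-- **REDUCTION OF THE QUOTIENT MAP** (E4P «REDUCTION OF `π`» of the Serre–Tate essential-surjectivity bookkeeping).  In the setting of
[Katz1981SerreTate] p. 142 (square-zero thickening `Spec (A⧸J) ↪ Spec A`, `X₀∕(A⧸J)` with `p`-divisible group `B₀` presented by `i₀`, `B∕A`
reducing to `B₀` via `c`, `Y∕A` reducing to `X₀` via the chart `GY`, `β : B[pⁿ] → Y` reducing to `(i₀)^p`, `Z ↪ Y` the image of `B[p²]`,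
`π : Y ↠ X` a finite flat surjective homomorphism with kernel `Z`, `iX : B[pⁿ] ↪ X` with `[p²] ≫ iX = β ≫ π`), the homomorphism `π`
REDUCES modulo `J` — through `GY` — to a HOMOMORPHISM `π₀ : X₀ → X ×_A (A⧸J)` (★ `AbelianSchemeOver.baseChange`) with `π₀ ≫ pr₁ = GY ≫ π`
on underlying schemes, finite, flat and surjective.  Proof: `π₀ := e_{GY} ≫ (π ×_A (A⧸J))` with `e_{GY} : X₀ ≅ Y ×_A (A⧸J)` the comparison
isomorphism of group schemes of the chart (★ `IsBaseChangeVia.isoBaseChange`, ★ `isMonHom_isoBaseChange_hom`) and `π ×_A (A⧸J) =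
(Over.pullback _).map π` (a homomorphism; finite ∕ flat ∕ surjective by base change, ★ `of_pullback_map_left`).  Statement = organ
`stub_E4P_reductionOfPi` of `Cruxes/HLiu418/Lines/F0_P6b_Sigma2ReductionOfQuotient.lean` with `IsTorsionTower` unfolded (most binders are
context only). [cite: Katz1981SerreTate, proof of Theorem 1.2.1 (§1.2, p. 142)] [cite: MumfordFogartyKirwan1994, Ch. 7 §2 Definition 7.2 (p. 129)]
[cite: GortzWedhorn2020, Section (4.7) (pp. 107–108)] -/
theorem exists_reductionOfQuotient :
    ∀ (p : ℕ), p.Prime → ∀ (A : Type) [CommRing A] [IsArtinianRing A] [IsLocalRing A], IsNilpotent (p : A) →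
      ∀ (J : Ideal A), J ≠ ⊤ → maximalIdeal A * J = ⊥ →
      ∀ (g : ℕ) (X₀ : AbelianSchemeOver (Spec (.of (A ⧸ J)))), X₀.IsOfRelDim g →
      ∀ (B₀ : BTGroup (Spec (.of (A ⧸ J))) p (2 * g)) (i₀ : ∀ n, B₀.G n ⟶ X₀.X),
        ((∀ n, letI := B₀.grpObj n; IsMonHom (i₀ n)) ∧
          (∀ n, IsPullback (i₀ n) (toUnit (B₀.G n)) (((𝟙 X₀.X : X₀.X ⟶ X₀.X) ^ (p ^ n) : X₀.X ⟶ X₀.X)) η[X₀.X]) ∧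
          (∀ n, B₀.incl n ≫ i₀ (n + 1) = i₀ n)) →
      ∀ (B : BTGroup (Spec (.of A)) p (2 * g)) (c : ∀ n, (B₀.G n).left ⟶ (B.G n).left),
        B₀.IsBaseChangeVia B (Spec.map (CommRingCat.ofHom (Ideal.Quotient.mk J))) c →
      ∀ (Y : AbelianSchemeOver (Spec (.of A))), Y.IsOfRelDim g → ∀ (GY : X₀.X.left ⟶ Y.X.left),
        X₀.IsBaseChangeVia Y (Spec.map (CommRingCat.ofHom (Ideal.Quotient.mk J))) GY →
      ∀ (β : ∀ n, B.G n ⟶ Y.X), (∀ n, letI := B.grpObj n; IsMonHom (β n)) → (∀ n, B.incl n ≫ β (n + 1) = β n) →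
        (∀ n, c n ≫ (β n).left = ((i₀ n) ^ p).left ≫ GY) →
      ∀ (Z : Over (Spec (.of A))) (iZ : Z ⟶ Y.X) (b : B.G 2 ⟶ Z), IsClosedImmersion iZ.left → IsFinite Z.hom → Flat Z.hom →
        b ≫ iZ = β 2 → Flat b.left → Surjective b.left →
      ∀ (X : AbelianSchemeOver (Spec (.of A))), X.IsOfRelDim g → ∀ (π : Y.X ⟶ X.X), IsMonHom π → IsFinite π.left → Flat π.left →
        Surjective π.left → (∀ (T : Over (Spec (.of A))) (u : T ⟶ Y.X), u ≫ π = 1 ↔ ∃ v : T ⟶ Z, v ≫ iZ = u) →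
      ∀ (iX : ∀ n, B.G n ⟶ X.X),
        ((∀ n, letI := B.grpObj n; IsMonHom (iX n)) ∧
          (∀ n, IsPullback (iX n) (toUnit (B.G n)) (((𝟙 X.X : X.X ⟶ X.X) ^ (p ^ n) : X.X ⟶ X.X)) η[X.X]) ∧
          (∀ n, B.incl n ≫ iX (n + 1) = iX n)) →
        (∀ n, B.pMap (n + 1) ≫ B.pMap n ≫ iX n = β (n + 2) ≫ π) →
        ∃ π₀ : X₀.X ⟶ (X.baseChange (Spec.map (CommRingCat.ofHom (Ideal.Quotient.mk J)))).X, IsMonHom π₀ ∧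
          π₀.left ≫ pullback.fst X.X.hom (Spec.map (CommRingCat.ofHom (Ideal.Quotient.mk J))) = GY ≫ π.left ∧
          IsFinite π₀.left ∧ Flat π₀.left ∧ Surjective π₀.left := by
  intro p _ A _ _ _ _ J _ _ g X₀ _ B₀ i₀ _ B c _ Y _ GY hGY β _ _ _ Z iZ b _ _ _ _ _ _ X _ π hπ hπf hπfl hπs _ iX _ _
  haveI := hπ
  haveI := hGY.isMonHom_isoBaseChange_hom
  -- the base change `π ×_A (A⧸J)` of `π`, a homomorphism `Y ×_A (A⧸J) → X ×_A (A⧸J)`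
  let πJ : (Y.baseChange (Spec.map (CommRingCat.ofHom (Ideal.Quotient.mk J)))).X ⟶
      (X.baseChange (Spec.map (CommRingCat.ofHom (Ideal.Quotient.mk J)))).X :=
    (Over.pullback (Spec.map (CommRingCat.ofHom (Ideal.Quotient.mk J)))).map π
  haveI : IsMonHom πJ := by
    change IsMonHom ((Over.pullback (Spec.map (CommRingCat.ofHom (Ideal.Quotient.mk J)))).map π)
    infer_instance
  have hπJ : πJ.left ≫ pullback.fst X.X.hom (Spec.map (CommRingCat.ofHom (Ideal.Quotient.mk J))) =
      pullback.fst Y.X.hom (Spec.map (CommRingCat.ofHom (Ideal.Quotient.mk J))) ≫ π.left :=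
    (congrArg (· ≫ pullback.fst X.X.hom _) (Over.pullback_map_left _ Y.X (k := π))).trans (pullback.lift_fst _ _ _)
  haveI : IsFinite πJ.left := of_pullback_map_left _ π hπf
  haveI : Flat πJ.left := of_pullback_map_left _ π hπfl
  haveI : Surjective πJ.left := of_pullback_map_left _ π hπs
  refine ⟨hGY.isoBaseChange.hom ≫ πJ, inferInstance, ?_, ?_, ?_, ?_⟩
  · rw [Over.comp_left, Category.assoc, hπJ, hGY.isoBaseChange_hom_left_fst_assoc]
  · rw [Over.comp_left]; infer_instance
  · rw [Over.comp_left]; infer_instance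
  · rw [Over.comp_left]; infer_instance

/-! ### §2 Tower compatibility of any `p`-dividing chart -/

/-- **TOWER COMPATIBILITY OF A `p`-DIVIDING CHART** (E4T «TOWER COMPATIBILITY» of the Serre–Tate essential-surjectivity bookkeeping).  In the
setting of [Katz1981SerreTate] p. 142 (as in `exists_reductionOfQuotient`), ANY base-change square of group schemes `G : X₀ → X` over
`Spec (A⧸J) ↪ Spec A` with `[p] ≫ G = GY ≫ π` matches the towers: `i₀ n ≫ G = c n ≫ iX n` on underlying schemes.  Proof: test against the
faithfully flat, hence epimorphic (Mathlib `Flat.epi_of_flat_of_surjective`), `[p²] = pMap (n+1) ≫ pMap n : B₀[pⁿ⁺²] ↠ B₀[pⁿ]`: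
`pMap ≫ pMap ≫ i₀ n ≫ G = (i₀ (n+2))^p ≫ [p] ≫ G = (i₀ (n+2))^p ≫ GY ≫ π = c (n+2) ≫ β (n+2) ≫ π = c (n+2) ≫ pMap ≫ pMap ≫ iX n = pMap ≫ pMap ≫
c n ≫ iX n` (§0: `pMap_pMap_comp_eq_pow_comp_pow_id`, the dividing relation, the reduction clause of `β`, the relation of `iX`,
`pMap_left_comp_of_isBaseChangeVia` twice).  Statement = organ `stub_E4T_towerCompatibility` of
`Cruxes/HLiu418/Lines/F0_P6b_Sigma2ReductionOfQuotient.lean` with `IsTorsionTower` unfolded (most binders are context only; neither the chart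
property of `G` nor the kernel clause is used). [cite: Katz1981SerreTate, proof of Theorem 1.2.1 (§1.2, p. 142)] [cite: Messing1972, Ch. I (1.1)–(1.6)]
[cite: Tate1967, §2 (2.1)] -/
theorem towerCompatibility_of_pDividingChart :
    ∀ (p : ℕ), p.Prime → ∀ (A : Type) [CommRing A] [IsArtinianRing A] [IsLocalRing A], IsNilpotent (p : A) →
      ∀ (J : Ideal A), J ≠ ⊤ → maximalIdeal A * J = ⊥ →
      ∀ (g : ℕ) (X₀ : AbelianSchemeOver (Spec (.of (A ⧸ J)))), X₀.IsOfRelDim g →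
      ∀ (B₀ : BTGroup (Spec (.of (A ⧸ J))) p (2 * g)) (i₀ : ∀ n, B₀.G n ⟶ X₀.X),
        ((∀ n, letI := B₀.grpObj n; IsMonHom (i₀ n)) ∧
          (∀ n, IsPullback (i₀ n) (toUnit (B₀.G n)) (((𝟙 X₀.X : X₀.X ⟶ X₀.X) ^ (p ^ n) : X₀.X ⟶ X₀.X)) η[X₀.X]) ∧
          (∀ n, B₀.incl n ≫ i₀ (n + 1) = i₀ n)) →
      ∀ (B : BTGroup (Spec (.of A)) p (2 * g)) (c : ∀ n, (B₀.G n).left ⟶ (B.G n).left),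
        B₀.IsBaseChangeVia B (Spec.map (CommRingCat.ofHom (Ideal.Quotient.mk J))) c →
      ∀ (Y : AbelianSchemeOver (Spec (.of A))), Y.IsOfRelDim g → ∀ (GY : X₀.X.left ⟶ Y.X.left),
        X₀.IsBaseChangeVia Y (Spec.map (CommRingCat.ofHom (Ideal.Quotient.mk J))) GY →
      ∀ (β : ∀ n, B.G n ⟶ Y.X), (∀ n, letI := B.grpObj n; IsMonHom (β n)) → (∀ n, B.incl n ≫ β (n + 1) = β n) →
        (∀ n, c n ≫ (β n).left = ((i₀ n) ^ p).left ≫ GY) →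
      ∀ (Z : Over (Spec (.of A))) (iZ : Z ⟶ Y.X) (b : B.G 2 ⟶ Z), IsClosedImmersion iZ.left → IsFinite Z.hom → Flat Z.hom →
        b ≫ iZ = β 2 → Flat b.left → Surjective b.left →
      ∀ (X : AbelianSchemeOver (Spec (.of A))), X.IsOfRelDim g → ∀ (π : Y.X ⟶ X.X), IsMonHom π → IsFinite π.left → Flat π.left →
        Surjective π.left → (∀ (T : Over (Spec (.of A))) (u : T ⟶ Y.X), u ≫ π = 1 ↔ ∃ v : T ⟶ Z, v ≫ iZ = u) →
      ∀ (iX : ∀ n, B.G n ⟶ X.X),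
        ((∀ n, letI := B.grpObj n; IsMonHom (iX n)) ∧
          (∀ n, IsPullback (iX n) (toUnit (B.G n)) (((𝟙 X.X : X.X ⟶ X.X) ^ (p ^ n) : X.X ⟶ X.X)) η[X.X]) ∧
          (∀ n, B.incl n ≫ iX (n + 1) = iX n)) →
        (∀ n, B.pMap (n + 1) ≫ B.pMap n ≫ iX n = β (n + 2) ≫ π) →
        ∀ (G : X₀.X.left ⟶ X.X.left), X₀.IsBaseChangeVia X (Spec.map (CommRingCat.ofHom (Ideal.Quotient.mk J))) G →
          ((𝟙 X₀.X : X₀.X ⟶ X₀.X) ^ p).left ≫ G = GY ≫ π.left → ∀ n, (i₀ n).left ≫ G = c n ≫ (iX n).left := by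
  intro p _ A _ _ _ _ J _ _ g X₀ _ B₀ i₀ hT₀ B c hBc Y _ GY _ β _ _ hβ Z iZ b _ _ _ _ _ _ X _ π _ _ _ _ _ iX _ hiXβ G _ hdiv n
  -- the test epimorphism `[p²] = pMap (n+1) ≫ pMap n : B₀.G (n+2) ↠ B₀.G n` (faithfully flat)
  haveI := B₀.flat_pMap n
  haveI := B₀.surjective_pMap n
  haveI := B₀.flat_pMap (n + 1)
  haveI := B₀.surjective_pMap (n + 1)
  haveI : Epi (B₀.pMap n).left := Flat.epi_of_flat_of_surjective _
  haveI : Epi (B₀.pMap (n + 1)).left := Flat.epi_of_flat_of_surjective _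
  rw [← cancel_epi (B₀.pMap n).left, ← cancel_epi (B₀.pMap (n + 1)).left]
  calc (B₀.pMap (n + 1)).left ≫ (B₀.pMap n).left ≫ (i₀ n).left ≫ G
      = (B₀.pMap (n + 1) ≫ B₀.pMap n ≫ i₀ n).left ≫ G := by simp only [Over.comp_left, Category.assoc]
    _ = ((i₀ (n + 2) ^ p) ≫ ((𝟙 X₀.X : X₀.X ⟶ X₀.X) ^ p)).left ≫ G := by
          rw [pMap_pMap_comp_eq_pow_comp_pow_id B₀ i₀ hT₀.1 hT₀.2.2 n]
    _ = (i₀ (n + 2) ^ p).left ≫ GY ≫ π.left := by rw [Over.comp_left, Category.assoc, hdiv]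
    _ = c (n + 2) ≫ (β (n + 2) ≫ π).left := by rw [← Category.assoc, ← hβ (n + 2), Category.assoc, Over.comp_left]
    _ = c (n + 2) ≫ (B.pMap (n + 1)).left ≫ (B.pMap n).left ≫ (iX n).left := by
          rw [← hiXβ n, Over.comp_left, Over.comp_left]
    _ = (B₀.pMap (n + 1)).left ≫ (B₀.pMap n).left ≫ c n ≫ (iX n).left := by
          rw [← Category.assoc, ← pMap_left_comp_of_isBaseChangeVia hBc (n + 1), Category.assoc, ← Category.assoc (c (n + 1)),
            ← pMap_left_comp_of_isBaseChangeVia hBc n, Category.assoc]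

end SerreTate

end Literature.AlgebraicGeometry.AbelianSchemes

end
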